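import Literature.MathematicalPhysics.QuantumLattice.HubbardFermiSurfaceSmearing
import Summits.HubbardSuperconductivity.HubbardLadder.HubbardOneBodyRows
import Summits.HubbardSuperconductivity.HubbardLadder.HubbardDopedDoubleOccRows
import HarnessLib

/-!
# R2 rows (device D24): momentum-distribution (Fermi-surface smearing) rows of the `4 × 4` Hubbard torus

HONEST FRAMING: ladder R1–R4 with certified numbers; no claim on H/H₀.

Object: ground states `ψ` (normalised, particle sector `N`) of the pure Hubbard model
`hamiltonian (fermionTorusGraph 2 4) 1 U` on the `4 × 4` torus, `N = 16` (`U ∈ {2,4,6,8}`) and `N = 14`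
(`U ∈ {4,8}`). Observable: the Bloch occupations `x_{kσ} = Re⟨ψ, n_{kσ}ψ⟩` through the named sums of the
Literature kernel `FermiSmearing` (`HubbardFermiSurfaceSmearing.lean`): the smearing functional at the Fermi
level `μ = 0`, `W_0 = 4 h_Γ + 2 H_{-2} + 2 P_{+2} + 4 n_Q` (holes in the closed Fermi sea `ε < 0` and particles
in the empty levels `ε > 0`, spin-summed, weighted by `|ε|`), the displaced-electron number
`dev = holesBelow + nAbove`, the number of electrons `nInside` in the eleven levels `ε ≤ 0` (closed Fermi sea
plus the half-filled open shell) and the corner pair `h_Γ + n_Q` (holes at `Γ`, particles at `Q = (π,π)`).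

Device: the kernel identity `W_0(ψ) = Re⟨ψ, H₀ψ⟩ + 24` (`smearing_zero_four_eq`: Fermi-surface smearing IS
the kinetic energy above the free value `-24`) turns every landed kinetic-energy window
`Re⟨ψ,H₀ψ⟩/16 ∈ [k_lo, k_hi]` (`HubbardOneBodyRows`, `HubbardDopedDoubleOccRows`, claim form over the typed
certificate nodes) into `W_0 ∈ [16 k_lo + 24, 16 k_hi + 24]`, and Markov's inequality on the level spacing
(`two_mul_dev_le_smearing_zero`, `smearing_zero_le_four_mul_dev`, `four_mul_corner_le_smearing_zero`,
`nInside_add_nAbove`) into occupation-number statements. Rows (outward decimals, exact arithmetic):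
* `N = 16`, `U = 2`: `W_0 ≤ 2.0032`; `dev ≤ 1.0016`;
  `nInside ≥ 14.9984` of 16; `h_Γ + n_Q ≤ 0.5008` of 4.
* `N = 16`, `U = 4`: `W_0 ≤ 5.3616`, `W_0 ≥ 1.2800`; `dev ≤ 2.6808`, `dev ≥ 0.3200`;
  `nInside ≥ 13.3192` of 16; `h_Γ + n_Q ≤ 1.3404` of 4.
* `N = 16`, `U = 6`: `W_0 ≤ 8.9104`, `W_0 ≥ 2.9888`; `dev ≤ 4.4552`, `dev ≥ 0.7472`;
  `nInside ≥ 11.5448` of 16; `h_Γ + n_Q ≤ 2.2276` of 4.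
* `N = 16`, `U = 8`: `W_0 ≤ 11.4432`, `W_0 ≥ 4.9536`; `dev ≤ 5.7216`, `dev ≥ 1.2384`;
  `nInside ≥ 10.2784` of 16; `h_Γ + n_Q ≤ 2.8608` of 4.
* `N = 14`, `U = 4`: `W_0 ≤ 6.0336`; `dev ≤ 3.0168`;
  `nInside ≥ 10.9832` of 14; `h_Γ + n_Q ≤ 1.5084` of 4.
* `N = 14`, `U = 8`: `W_0 ≤ 12.1328`, `W_0 ≥ 2.6368`; `dev ≤ 6.0664`, `dev ≥ 0.6592`;
  `nInside ≥ 7.9336` of 14; `h_Γ + n_Q ≤ 3.0332` of 4.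

Every certificate node is an OPEN obligation BY NAME (hypothesis). No sorry. WEAK label: an ED-able cluster;
the content is the TYPE — certified statements on the momentum distribution `n(k)` of Hubbard ground states
(the interaction-broadened Fermi step measured by DQMC, Varney et al. 2009 §3, and by optical-lattice band
mapping), e.g. at `U = 2` at least `14.99` of the `16` electrons occupy the free Fermi sea and its open shell,
at `U = 8` at least `10.27`, while at least `1.23` electron-equivalents are displaced across the Fermi level.
-/

namespace Summit.HubbardSuperconductivity.HubbardLadder

open Literature.MathematicalPhysics.QuantumLattice Literature.Probability.LatticeModels Matrix
open Literature.MathematicalPhysics.QuantumLattice.FermiSmearing Bounds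

/-- `⟨ψ,ψ⟩ = 1` as a real part. [cite: Tasaki2020, §2.1] -/
theorem re_star_dotProduct_self_of_eq_one {ψ : Fock (Orb (FermionTorus 2 4))} (hψ1 : star ψ ⬝ᵥ ψ = 1) :
    (star ψ ⬝ᵥ ψ).re = 1 := by
  rw [hψ1, Complex.one_re]

/-- From a kinetic window to the smearing window: `W_0 = 16 k + 24`. [cite: LiebLoss2001, Theorem 1.14] -/
theorem smearing_zero_mem_Icc_of_kinetic {N : ℕ} {ψ : Fock (Orb (FermionTorus 2 4))} (hN : IsNParticle N ψ)
    (hψ1 : star ψ ⬝ᵥ ψ = 1) {lo hi : ℝ}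
    (hk : (expect (hamiltonian (fermionTorusGraph 2 4) 1 0) ψ).re / 16 ∈ Set.Icc lo hi) :
    smearing 0 ψ ∈ Set.Icc (16 * lo + 24) (16 * hi + 24) := by
  have hW := smearing_zero_four_eq hN
  have hK : (expect (hamiltonian (fermionTorusGraph 2 4) 1 0) ψ).re =
      (star ψ ⬝ᵥ (hubbardTorus 2 4 1 0 *ᵥ ψ)).re := rfl
  rw [re_star_dotProduct_self_of_eq_one hψ1, ← hK] at hW
  obtain ⟨h1, h2⟩ := hk
  rw [le_div_iff₀ (by norm_num : (0 : ℝ) < 16)] at h1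
  rw [div_le_iff₀ (by norm_num : (0 : ℝ) < 16)] at h2
  rw [hW]
  constructor <;> linarith

/-- From a smearing window to the occupation rows: `dev ∈ [W_lo/4, W_hi/2]`, `nInside ≥ N - W_hi/2`,
`h_Γ + n_Q ≤ W_hi/4`. [cite: LiebLoss2001, Theorem 1.14] -/
theorem occupationRows_of_smearing {N : ℕ} {ψ : Fock (Orb (FermionTorus 2 4))} (hN : IsNParticle N ψ)
    (hψ1 : star ψ ⬝ᵥ ψ = 1) {Wlo Whi : ℝ} (hW : smearing 0 ψ ∈ Set.Icc Wlo Whi) :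
    holesBelow ψ + nAbove ψ ∈ Set.Icc (Wlo / 4) (Whi / 2) ∧ (N : ℝ) - Whi / 2 ≤ nInside ψ ∧
      (∑ σ : Fin 2, (1 - occ 0 σ ψ)) + ∑ σ : Fin 2, occ cornerQ σ ψ ≤ Whi / 4 := by
  obtain ⟨h1, h2⟩ := hW
  have ha := two_mul_dev_le_smearing_zero ψ
  have hb := smearing_zero_le_four_mul_dev ψ
  have hc := four_mul_corner_le_smearing_zero ψ
  have hd := nInside_add_nAbove hN
  have he := holesBelow_nonneg ψ
  have h1' := re_star_dotProduct_self_of_eq_one hψ1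
  simp only [h1'] at hc hd
  refine ⟨⟨by linarith, by linarith⟩, by linarith, by linarith⟩

/-! ### `N = 16`, `U = 2` -/

/-- **R2 row (D24) `N = 16`, `U = 2`**: Fermi-surface smearing `W_0 ∈ [0.0000, 2.0032]` for every
normalised ground state (`W_0 = 4h_Γ + 2H_(-2) + 2P_(+2) + 4n_Q`; free value `0`).
[cite: LiebLoss2001, Theorem 1.14] -/
theorem smearing_four_U2_mem_Icc_of_claims {ψ : Fock (Orb (FermionTorus 2 4))}
    (hψ : IsGroundState (hamiltonian (fermionTorusGraph 2 4) 1 2) 16 ψ) (hψ1 : star ψ ⬝ᵥ ψ = 1)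
    (h₂ : torusUpper_mbbootE2_4x4_U2_N16) (h₄ : torusLower_mbboot_4x4_U4_N16) :
    smearing 0 ψ ∈ Set.Icc (0.0000 : ℝ) 2.0032 := by
  have h := smearing_zero_mem_Icc_of_kinetic hψ.1 hψ1 (kineticPerSite_four_U2_mem_Icc_of_claims hψ hψ1 h₂ h₄)
  exact ⟨le_trans (by norm_num) h.1, le_trans h.2 (by norm_num)⟩

/-- **R2 rows (D24) `N = 16`, `U = 2`, occupations**: displaced electrons `holesBelow + nAbove ∈
[0.0000, 1.0016]`; electrons in the eleven levels `ε ≤ 0`: `nInside ≥ 14.9984` (of `16`);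
corner pair `h_Γ + n_Q ≤ 0.5008` (of `4`). [cite: VarneyEtAl2009, §3] -/
theorem occupationRows_four_U2_of_claims {ψ : Fock (Orb (FermionTorus 2 4))}
    (hψ : IsGroundState (hamiltonian (fermionTorusGraph 2 4) 1 2) 16 ψ) (hψ1 : star ψ ⬝ᵥ ψ = 1)
    (h₂ : torusUpper_mbbootE2_4x4_U2_N16) (h₄ : torusLower_mbboot_4x4_U4_N16) :
    holesBelow ψ + nAbove ψ ∈ Set.Icc (0.0000 : ℝ) 1.0016 ∧ (14.9984 : ℝ) ≤ nInside ψ ∧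
      (∑ σ : Fin 2, (1 - occ 0 σ ψ)) + ∑ σ : Fin 2, occ cornerQ σ ψ ≤ 0.5008 := by
  have h := occupationRows_of_smearing hψ.1 hψ1 (smearing_four_U2_mem_Icc_of_claims hψ hψ1 h₂ h₄)
  norm_num at h ⊢
  exact h

/-! ### `N = 16`, `U = 4` -/

/-- **R2 row (D24) `N = 16`, `U = 4`**: Fermi-surface smearing `W_0 ∈ [1.2800, 5.3616]` for every
normalised ground state (`W_0 = 4h_Γ + 2H_(-2) + 2P_(+2) + 4n_Q`; free value `0`).
[cite: LiebLoss2001, Theorem 1.14] -/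
theorem smearing_four_U4_mem_Icc_of_claims {ψ : Fock (Orb (FermionTorus 2 4))}
    (hψ : IsGroundState (hamiltonian (fermionTorusGraph 2 4) 1 4) 16 ψ) (hψ1 : star ψ ⬝ᵥ ψ = 1)
    (h₂ : torusLower_mbboot_4x4_U2_N16) (h₄ : torusUpper_mbbootE2_4x4_U4_N16) (h₆ : torusLower_mbboot_4x4_U6_N16) :
    smearing 0 ψ ∈ Set.Icc (1.2800 : ℝ) 5.3616 := by
  have h := smearing_zero_mem_Icc_of_kinetic hψ.1 hψ1 (kineticPerSite_four_U4_mem_Icc_of_claims hψ hψ1 h₂ h₄ h₆)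
  exact ⟨le_trans (by norm_num) h.1, le_trans h.2 (by norm_num)⟩

/-- **R2 rows (D24) `N = 16`, `U = 4`, occupations**: displaced electrons `holesBelow + nAbove ∈
[0.3200, 2.6808]`; electrons in the eleven levels `ε ≤ 0`: `nInside ≥ 13.3192` (of `16`);
corner pair `h_Γ + n_Q ≤ 1.3404` (of `4`). [cite: VarneyEtAl2009, §3] -/
theorem occupationRows_four_U4_of_claims {ψ : Fock (Orb (FermionTorus 2 4))}
    (hψ : IsGroundState (hamiltonian (fermionTorusGraph 2 4) 1 4) 16 ψ) (hψ1 : star ψ ⬝ᵥ ψ = 1)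
    (h₂ : torusLower_mbboot_4x4_U2_N16) (h₄ : torusUpper_mbbootE2_4x4_U4_N16) (h₆ : torusLower_mbboot_4x4_U6_N16) :
    holesBelow ψ + nAbove ψ ∈ Set.Icc (0.3200 : ℝ) 2.6808 ∧ (13.3192 : ℝ) ≤ nInside ψ ∧
      (∑ σ : Fin 2, (1 - occ 0 σ ψ)) + ∑ σ : Fin 2, occ cornerQ σ ψ ≤ 1.3404 := by
  have h := occupationRows_of_smearing hψ.1 hψ1 (smearing_four_U4_mem_Icc_of_claims hψ hψ1 h₂ h₄ h₆)
  norm_num at h ⊢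
  exact h

/-! ### `N = 16`, `U = 6` -/

/-- **R2 row (D24) `N = 16`, `U = 6`**: Fermi-surface smearing `W_0 ∈ [2.9888, 8.9104]` for every
normalised ground state (`W_0 = 4h_Γ + 2H_(-2) + 2P_(+2) + 4n_Q`; free value `0`).
[cite: LiebLoss2001, Theorem 1.14] -/
theorem smearing_four_U6_mem_Icc_of_claims {ψ : Fock (Orb (FermionTorus 2 4))}
    (hψ : IsGroundState (hamiltonian (fermionTorusGraph 2 4) 1 6) 16 ψ) (hψ1 : star ψ ⬝ᵥ ψ = 1)
    (h₄ : torusLower_mbboot_4x4_U4_N16) (h₆ : torusUpper_mbbootE2_4x4_U6_N16) (h₈ : torusLower_mbboot_4x4_U8_N16) :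
    smearing 0 ψ ∈ Set.Icc (2.9888 : ℝ) 8.9104 := by
  have h := smearing_zero_mem_Icc_of_kinetic hψ.1 hψ1 (kineticPerSite_four_U6_mem_Icc_of_claims hψ hψ1 h₄ h₆ h₈)
  exact ⟨le_trans (by norm_num) h.1, le_trans h.2 (by norm_num)⟩

/-- **R2 rows (D24) `N = 16`, `U = 6`, occupations**: displaced electrons `holesBelow + nAbove ∈
[0.7472, 4.4552]`; electrons in the eleven levels `ε ≤ 0`: `nInside ≥ 11.5448` (of `16`);
corner pair `h_Γ + n_Q ≤ 2.2276` (of `4`). [cite: VarneyEtAl2009, §3] -/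
theorem occupationRows_four_U6_of_claims {ψ : Fock (Orb (FermionTorus 2 4))}
    (hψ : IsGroundState (hamiltonian (fermionTorusGraph 2 4) 1 6) 16 ψ) (hψ1 : star ψ ⬝ᵥ ψ = 1)
    (h₄ : torusLower_mbboot_4x4_U4_N16) (h₆ : torusUpper_mbbootE2_4x4_U6_N16) (h₈ : torusLower_mbboot_4x4_U8_N16) :
    holesBelow ψ + nAbove ψ ∈ Set.Icc (0.7472 : ℝ) 4.4552 ∧ (11.5448 : ℝ) ≤ nInside ψ ∧
      (∑ σ : Fin 2, (1 - occ 0 σ ψ)) + ∑ σ : Fin 2, occ cornerQ σ ψ ≤ 2.2276 := by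
  have h := occupationRows_of_smearing hψ.1 hψ1 (smearing_four_U6_mem_Icc_of_claims hψ hψ1 h₄ h₆ h₈)
  norm_num at h ⊢
  exact h

/-! ### `N = 16`, `U = 8` -/

/-- **R2 row (D24) `N = 16`, `U = 8`**: Fermi-surface smearing `W_0 ∈ [4.9536, 11.4432]` for every
normalised ground state (`W_0 = 4h_Γ + 2H_(-2) + 2P_(+2) + 4n_Q`; free value `0`).
[cite: LiebLoss2001, Theorem 1.14] -/
theorem smearing_four_U8_mem_Icc_of_claims {ψ : Fock (Orb (FermionTorus 2 4))}
    (hψ : IsGroundState (hamiltonian (fermionTorusGraph 2 4) 1 8) 16 ψ) (hψ1 : star ψ ⬝ᵥ ψ = 1)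
    (h₆ : torusLower_mbboot_4x4_U6_N16) (h₈ : torusUpper_mbbootE2_4x4_U8_N16) (h₁₂ : torusLower_mbboot_4x4_U12_N16) :
    smearing 0 ψ ∈ Set.Icc (4.9536 : ℝ) 11.4432 := by
  have h := smearing_zero_mem_Icc_of_kinetic hψ.1 hψ1 (kineticPerSite_four_U8_mem_Icc_of_claims hψ hψ1 h₆ h₈ h₁₂)
  exact ⟨le_trans (by norm_num) h.1, le_trans h.2 (by norm_num)⟩

/-- **R2 rows (D24) `N = 16`, `U = 8`, occupations**: displaced electrons `holesBelow + nAbove ∈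
[1.2384, 5.7216]`; electrons in the eleven levels `ε ≤ 0`: `nInside ≥ 10.2784` (of `16`);
corner pair `h_Γ + n_Q ≤ 2.8608` (of `4`). [cite: VarneyEtAl2009, §3] -/
theorem occupationRows_four_U8_of_claims {ψ : Fock (Orb (FermionTorus 2 4))}
    (hψ : IsGroundState (hamiltonian (fermionTorusGraph 2 4) 1 8) 16 ψ) (hψ1 : star ψ ⬝ᵥ ψ = 1)
    (h₆ : torusLower_mbboot_4x4_U6_N16) (h₈ : torusUpper_mbbootE2_4x4_U8_N16) (h₁₂ : torusLower_mbboot_4x4_U12_N16) :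
    holesBelow ψ + nAbove ψ ∈ Set.Icc (1.2384 : ℝ) 5.7216 ∧ (10.2784 : ℝ) ≤ nInside ψ ∧
      (∑ σ : Fin 2, (1 - occ 0 σ ψ)) + ∑ σ : Fin 2, occ cornerQ σ ψ ≤ 2.8608 := by
  have h := occupationRows_of_smearing hψ.1 hψ1 (smearing_four_U8_mem_Icc_of_claims hψ hψ1 h₆ h₈ h₁₂)
  norm_num at h ⊢
  exact h

/-! ### `N = 14`, `U = 4` -/

/-- **R2 row (D24) `N = 14`, `U = 4`**: Fermi-surface smearing `W_0 ∈ [0.0000, 6.0336]` for every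
normalised ground state (`W_0 = 4h_Γ + 2H_(-2) + 2P_(+2) + 4n_Q`; free value `0`).
[cite: LiebLoss2001, Theorem 1.14] -/
theorem smearing_four_N14_U4_mem_Icc_of_claims {ψ : Fock (Orb (FermionTorus 2 4))}
    (hψ : IsGroundState (hamiltonian (fermionTorusGraph 2 4) 1 4) 14 ψ) (hψ1 : star ψ ⬝ᵥ ψ = 1)
    (h₄ : torusUpper_mbbootB2_4x4_U4_N14) (h₈ : torusLower_mbboot_4x4_U8_N14) :
    smearing 0 ψ ∈ Set.Icc (0.0000 : ℝ) 6.0336 := by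
  have h := smearing_zero_mem_Icc_of_kinetic hψ.1 hψ1 (kineticPerSite_four_N14_U4_mem_Icc_of_claims hψ hψ1 h₄ h₈)
  exact ⟨le_trans (by norm_num) h.1, le_trans h.2 (by norm_num)⟩

/-- **R2 rows (D24) `N = 14`, `U = 4`, occupations**: displaced electrons `holesBelow + nAbove ∈
[0.0000, 3.0168]`; electrons in the eleven levels `ε ≤ 0`: `nInside ≥ 10.9832` (of `14`);
corner pair `h_Γ + n_Q ≤ 1.5084` (of `4`). [cite: VarneyEtAl2009, §3] -/
theorem occupationRows_four_N14_U4_of_claims {ψ : Fock (Orb (FermionTorus 2 4))}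
    (hψ : IsGroundState (hamiltonian (fermionTorusGraph 2 4) 1 4) 14 ψ) (hψ1 : star ψ ⬝ᵥ ψ = 1)
    (h₄ : torusUpper_mbbootB2_4x4_U4_N14) (h₈ : torusLower_mbboot_4x4_U8_N14) :
    holesBelow ψ + nAbove ψ ∈ Set.Icc (0.0000 : ℝ) 3.0168 ∧ (10.9832 : ℝ) ≤ nInside ψ ∧
      (∑ σ : Fin 2, (1 - occ 0 σ ψ)) + ∑ σ : Fin 2, occ cornerQ σ ψ ≤ 1.5084 := by
  have h := occupationRows_of_smearing hψ.1 hψ1 (smearing_four_N14_U4_mem_Icc_of_claims hψ hψ1 h₄ h₈)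
  norm_num at h ⊢
  exact h

/-! ### `N = 14`, `U = 8` -/

/-- **R2 row (D24) `N = 14`, `U = 8`**: Fermi-surface smearing `W_0 ∈ [2.6368, 12.1328]` for every
normalised ground state (`W_0 = 4h_Γ + 2H_(-2) + 2P_(+2) + 4n_Q`; free value `0`).
[cite: LiebLoss2001, Theorem 1.14] -/
theorem smearing_four_N14_U8_mem_Icc_of_claims {ψ : Fock (Orb (FermionTorus 2 4))}
    (hψ : IsGroundState (hamiltonian (fermionTorusGraph 2 4) 1 8) 14 ψ) (hψ1 : star ψ ⬝ᵥ ψ = 1)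
    (h₄ : torusLower_mbboot_4x4_U4_N14) (h₈ : torusUpper_mbbootE2_4x4_U8_N14) :
    smearing 0 ψ ∈ Set.Icc (2.6368 : ℝ) 12.1328 := by
  have h := smearing_zero_mem_Icc_of_kinetic hψ.1 hψ1 (kineticPerSite_four_N14_U8_mem_Icc_of_claims hψ hψ1 h₄ h₈)
  exact ⟨le_trans (by norm_num) h.1, le_trans h.2 (by norm_num)⟩

/-- **R2 rows (D24) `N = 14`, `U = 8`, occupations**: displaced electrons `holesBelow + nAbove ∈
[0.6592, 6.0664]`; electrons in the eleven levels `ε ≤ 0`: `nInside ≥ 7.9336` (of `14`);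
corner pair `h_Γ + n_Q ≤ 3.0332` (of `4`). [cite: VarneyEtAl2009, §3] -/
theorem occupationRows_four_N14_U8_of_claims {ψ : Fock (Orb (FermionTorus 2 4))}
    (hψ : IsGroundState (hamiltonian (fermionTorusGraph 2 4) 1 8) 14 ψ) (hψ1 : star ψ ⬝ᵥ ψ = 1)
    (h₄ : torusLower_mbboot_4x4_U4_N14) (h₈ : torusUpper_mbbootE2_4x4_U8_N14) :
    holesBelow ψ + nAbove ψ ∈ Set.Icc (0.6592 : ℝ) 6.0664 ∧ (7.9336 : ℝ) ≤ nInside ψ ∧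
      (∑ σ : Fin 2, (1 - occ 0 σ ψ)) + ∑ σ : Fin 2, occ cornerQ σ ψ ≤ 3.0332 := by
  have h := occupationRows_of_smearing hψ.1 hψ1 (smearing_four_N14_U8_mem_Icc_of_claims hψ hψ1 h₄ h₈)
  norm_num at h ⊢
  exact h

end Summit.HubbardSuperconductivity.HubbardLadder
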